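import Summits.QuantumFields.YangMills.Theorems.BalabanUVNodesPortS1G3CWalkSum
import Summits.QuantumFields.YangMills.Theorems.BalabanUVNodesPortS1G3CLocOpsGauge
import Summits.QuantumFields.YangMills.Theorems.BalabanUVNodesPortS1G3CInvariance
import Summits.QuantumFields.YangMills.Theorems.BalabanUVNodesPortS1G3CTwinLocal

/-!
# NODE O port PT-A — `stub_G3C` (repaired edition `G3CAtRecordL`), layer (δ): ROWS (g4) LOCALITY AND (g6) INVARIANCE OF THE PIECES `EG` — termwise, for EVERY pair (no analyticity):
# the walk terms with localization `X` read the pair only on `domSites X` and are invariant under the (1.10) action (conjugation by the bond-block-diagonal `AdM(u)` telescopes inside the trace)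

Cell `ym-nodeO-ideate`, porter hand `hand-27930-G3C` (g1); `--supports stmt-QuantumFields-27930`; count-neutral.  [I] = [Balaban1987RG1], [16] = [Balaban1985UV3], [B9] = [Balaban1985BackgroundPropagators].

WHY (memo §5c «(g4)(g6): termwise»).  `EG x n X φ := collect X_full W (Tr A⁻¹) X` (✓`g3cEG`).  (g4): for `X ≠ X_full` it is the walk piece `W(X) = Σ'_m (−1)ᵐ Σ_{X(□₀,w)=X} t(□₀,w)`, and a walk term
with localization `X` is built from `G_{□̃}` (`□̃ ⊆ X`, ✓`g3cLocInv_congr_of_agreeOnSet`) and `T_Y`, `Y ⊆ X` ((P4) locality), all reading the pair on `domSites X` only; for `X_full` the collector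
`Tr A⁻¹ − Σ_{X′≠X_full} W(X′)` reads everything on `domSites X_full ⊇ domSites X′`.  (g6): under `φ ↦ u·φ` every `T_Y` and every `G_{□̃}` is conjugated by the unit `A = AdM(u)|_{nonB₀}`
((P3), ✓`g3cLocInv_cAct`), the sharp partition `𝟙_□` and the projections `P_□̃` commute with the bond-block-diagonal `A`, so every step matrix is conjugated, the ordered product telescopes
(✓`listProd_conj`) and the trace is invariant; the total `Tr A⁻¹` is invariant by ✓`trace_resolvent_nonB0_cAct`.

WHAT THIS FILE PROVES (sorry-free): `nonB0Block_TY_congr`, `g3cStepM_congr`, `g3cWalkTerm_congr`, `g3cWm_congr`, `g3cW_congr`, `nonB0Block_TC_congr`, ★`g3cEG_congr` ((g4) for every pair);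
`diagonal_comm_adM`, `nonB0Block_TY_cAct`, `g3cStepM_cAct`, `g3cWalkTerm_cAct`, `g3cW_cAct`, ★`g3cEG_cAct` ((g6) for every pair).

HONEST FRAMING.  Finite algebra under the HYPOTHESIS `P0CarrierClauses …` (inhabited nowhere); nothing of Bałaban asserted, ported or discharged; `stub_G3C` NOT closed; 27930 OPEN; NODE O 0∕1;
COUNT 8∕28 · K 1∕4 UNMOVED; finite `𝕋⁴_{L^K}` at fixed ε — NOT continuum ∕ OS ∕ Clay; **the Yang–Mills mass gap is NOT proved by any of this.**  No `sorry`, no `instance`, no `notation`;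
standard axioms.
-/

noncomputable section

open scoped BigOperators Matrix.Norms.L2Operator Topology Matrix Classical
open Filter Finset

namespace Summit.QuantumFields.YangMills.Theorems.BalabanUVNodesPortS1

open Summit.QuantumFields.YangMills.Theorems.K0RecordFormatNames
open Literature.MathematicalPhysics.QuantumFieldTheory.Balaban1983to89
open Literature.MathematicalPhysics.QuantumFieldTheory.Balaban1983to89.Node00
open Literature.MathematicalPhysics.QuantumFieldTheory.Balaban1983to89.T4Continuum (T4Family)
open Literature.MathematicalPhysics.QuantumFieldTheory.Balaban1983to89.TreeLengthTorus (TPt)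

section LocalGauge

variable {F : T4Family}
variable {a₀ δ₀ c₀ γ₀ γ₁ δ₁ : ℝ} {Mc : ℕ} {α₀ α₁ ε₂₉ : ℝ} {k : ℕ}
variable {TC : (n : ℕ) → Sect2.CPair (F.P (recordK₀ F Mc k + n)) (MatA 2) → FluctIdx F k (recordK₀ F Mc k + n) → FluctIdx F k (recordK₀ F Mc k + n) → ℂ}
variable {TY : (n : ℕ) → (recordDomSys F Mc k (recordK₀ F Mc k + n)).Dom → Sect2.CPair (F.P (recordK₀ F Mc k + n)) (MatA 2) →
  FluctIdx F k (recordK₀ F Mc k + n) → FluctIdx F k (recordK₀ F Mc k + n) → ℂ}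
variable {TZY : Finset (Fin 4 → ℤ) → IntBondCfg → ((Fin 4 → ℤ) × Fin 4) × Fin 3 → ((Fin 4 → ℤ) × Fin 4) × Fin 3 → ℂ}
variable {AdM : (n : ℕ) → (Site (F.P (recordK₀ F Mc k + n)) 0 → (MatA 2)ˣ) →
  Matrix (FluctIdx F k (recordK₀ F Mc k + n)) (FluctIdx F k (recordK₀ F Mc k + n)) ℂ}
variable {AdZ : ((Fin 4 → ℤ) → (MatA 2)ˣ) → (Fin 4 → ℤ) × Fin 4 → Matrix (Fin 3) (Fin 3) ℂ}

/-! ## §1  (g4) locality, termwise -/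

/-- `T_Y` on the non-`b₀` block reads the pair on `domSites Y` only ((P4) locality). [cite: Balaban1987RG1, (1.7) p.261] -/
theorem nonB0Block_TY_congr (hP : P0CarrierClauses F a₀ δ₀ c₀ γ₀ γ₁ Mc α₀ α₁ ε₂₉ k TC TY TZY AdM AdZ) (n : ℕ)
    (Y : (recordDomSys F Mc k (recordK₀ F Mc k + n)).Dom) {φ ψ : Sect2.CPair (F.P (recordK₀ F Mc k + n)) (MatA 2)}
    (h : Sect2.agreeOnSet (Sect2.domSites (F.P (recordK₀ F Mc k + n)) Mc (k + 1) Y) φ ψ) :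
    nonB0Block F k (recordK₀ F Mc k + n) (TY n Y φ) = nonB0Block F k (recordK₀ F Mc k + n) (TY n Y ψ) := by
  obtain ⟨-, -, -, -, -, -, -, -, -, hLoc, -⟩ := hP
  ext i j
  simp only [nonB0Block, Matrix.of_apply, hLoc n Y φ ψ h]

/-- The admissible step matrix `S^M_{□,Y}` reads the pair on `domSites X` only, for `Y ∪ □̃ ⊆ X`. [cite: Balaban1987RG1, (1.7) p.261] -/
theorem g3cStepM_congr (hP : P0CarrierClauses F a₀ δ₀ c₀ γ₀ γ₁ Mc α₀ α₁ ε₂₉ k TC TY TZY AdM AdZ) (n : ℕ)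
    {X : (recordDomSys F Mc k (recordK₀ F Mc k + n)).Dom} {φ ψ : Sect2.CPair (F.P (recordK₀ F Mc k + n)) (MatA 2)}
    (h : Sect2.agreeOnSet (Sect2.domSites (F.P (recordK₀ F Mc k + n)) Mc (k + 1) X) φ ψ) (x : ℝ)
    (s : TPt (F.P (recordK₀ F Mc k + n)).d (Sect2.domCount (F.P (recordK₀ F Mc k + n)) Mc (k + 1)) × (recordDomSys F Mc k (recordK₀ F Mc k + n)).Dom)
    (hY : (s.2.1 : Finset _) ⊆ X.1) (hB : ((g3cBlk F Mc k (recordK₀ F Mc k + n) s.1).1 : Finset _) ⊆ X.1) :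
    g3cStepM F Mc k (recordK₀ F Mc k + n) (TY n) x φ s = g3cStepM F Mc k (recordK₀ F Mc k + n) (TY n) x ψ s := by
  unfold g3cStepM g3cStep
  split_ifs
  · rfl
  · rw [nonB0Block_TY_congr hP n s.2 (Sect2.agreeOnSet_mono (domSites_subset_of_subset (F.P (recordK₀ F Mc k + n)) Mc (k + 1) hY) h),
      g3cLocInv_congr_of_agreeOnSet hP n _ x (Sect2.agreeOnSet_mono (domSites_subset_of_subset (F.P (recordK₀ F Mc k + n)) Mc (k + 1) hB) h)]

/-- A walk term with localization `X` reads the pair on `domSites X` only. [cite: Balaban1987RG1, (1.7) p.261] -/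
theorem g3cWalkTerm_congr (hP : P0CarrierClauses F a₀ δ₀ c₀ γ₀ γ₁ Mc α₀ α₁ ε₂₉ k TC TY TZY AdM AdZ) (n : ℕ)
    {X : (recordDomSys F Mc k (recordK₀ F Mc k + n)).Dom} {φ ψ : Sect2.CPair (F.P (recordK₀ F Mc k + n)) (MatA 2)}
    (h : Sect2.agreeOnSet (Sect2.domSites (F.P (recordK₀ F Mc k + n)) Mc (k + 1) X) φ ψ) (x : ℝ)
    (q₀ : TPt (F.P (recordK₀ F Mc k + n)).d (Sect2.domCount (F.P (recordK₀ F Mc k + n)) Mc (k + 1))) {m : ℕ}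
    (w : Fin m → TPt (F.P (recordK₀ F Mc k + n)).d (Sect2.domCount (F.P (recordK₀ F Mc k + n)) Mc (k + 1)) × (recordDomSys F Mc k (recordK₀ F Mc k + n)).Dom)
    (hloc : g3cWalkLoc F Mc k (recordK₀ F Mc k + n) q₀ w = X.1) :
    g3cWalkTerm F Mc k (recordK₀ F Mc k + n) (TY n) x φ q₀ w = g3cWalkTerm F Mc k (recordK₀ F Mc k + n) (TY n) x ψ q₀ w := by
  have hB0 : ((g3cBlk F Mc k (recordK₀ F Mc k + n) q₀).1 : Finset _) ⊆ X.1 := hloc ▸ blk_subset_g3cWalkLoc Mc k _ q₀ w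
  have hYi : ∀ i, ((w i).2.1 : Finset _) ⊆ X.1 := fun i => hloc ▸ dom_step_subset_g3cWalkLoc Mc k _ q₀ w i
  have hBi : ∀ i, ((g3cBlk F Mc k (recordK₀ F Mc k + n) (w i).1).1 : Finset _) ⊆ X.1 := fun i => hloc ▸ blk_step_subset_g3cWalkLoc Mc k _ q₀ w i
  have hlist : (fun i => g3cStepM F Mc k (recordK₀ F Mc k + n) (TY n) x φ (w i)) = fun i => g3cStepM F Mc k (recordK₀ F Mc k + n) (TY n) x ψ (w i) :=
    funext fun i => g3cStepM_congr hP n h x (w i) (hYi i) (hBi i)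
  rw [g3cWalkTerm, g3cWalkTerm, g3cLocInv_congr_of_agreeOnSet hP n _ x (Sect2.agreeOnSet_mono (domSites_subset_of_subset (F.P (recordK₀ F Mc k + n)) Mc (k + 1) hB0) h), hlist]

/-- `W_m(X)` reads the pair on `domSites X` only. [cite: Balaban1987RG1, (1.7) p.261] -/
theorem g3cWm_congr (hP : P0CarrierClauses F a₀ δ₀ c₀ γ₀ γ₁ Mc α₀ α₁ ε₂₉ k TC TY TZY AdM AdZ) (n : ℕ)
    (X : (recordDomSys F Mc k (recordK₀ F Mc k + n)).Dom) {φ ψ : Sect2.CPair (F.P (recordK₀ F Mc k + n)) (MatA 2)}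
    (h : Sect2.agreeOnSet (Sect2.domSites (F.P (recordK₀ F Mc k + n)) Mc (k + 1) X) φ ψ) (x : ℝ) (m : ℕ) :
    g3cWm F Mc k (recordK₀ F Mc k + n) (TY n) x φ m X = g3cWm F Mc k (recordK₀ F Mc k + n) (TY n) x ψ m X := by
  rw [g3cWm, g3cWm]
  refine Finset.sum_congr rfl fun q₀ _ => Finset.sum_congr rfl fun w _ => ?_
  by_cases hloc : g3cWalkLoc F Mc k (recordK₀ F Mc k + n) q₀ w = X.1
  · rw [if_pos hloc, if_pos hloc, g3cWalkTerm_congr hP n h x q₀ w hloc]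
  · rw [if_neg hloc, if_neg hloc]

/-- **The walk piece `W(X)` reads the pair on `domSites X` only.** [cite: Balaban1987RG1, (1.7) p.261] -/
theorem g3cW_congr (hP : P0CarrierClauses F a₀ δ₀ c₀ γ₀ γ₁ Mc α₀ α₁ ε₂₉ k TC TY TZY AdM AdZ) (n : ℕ)
    (X : (recordDomSys F Mc k (recordK₀ F Mc k + n)).Dom) {φ ψ : Sect2.CPair (F.P (recordK₀ F Mc k + n)) (MatA 2)}
    (h : Sect2.agreeOnSet (Sect2.domSites (F.P (recordK₀ F Mc k + n)) Mc (k + 1) X) φ ψ) (x : ℝ) :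
    g3cW F Mc k (recordK₀ F Mc k + n) (TY n) x φ X = g3cW F Mc k (recordK₀ F Mc k + n) (TY n) x ψ X := by
  rw [g3cW, g3cW]
  exact tsum_congr fun m => by rw [g3cWm_congr hP n X h x m]

/-- The non-`b₀` block of the TOTAL carrier reads the pair on `domSites X_full` ((P4): `TC = Σ_Y TY`, each piece local). [cite: Balaban1987RG1, (1.7) p.261] -/
theorem nonB0Block_TC_congr (hP : P0CarrierClauses F a₀ δ₀ c₀ γ₀ γ₁ Mc α₀ α₁ ε₂₉ k TC TY TZY AdM AdZ) (n : ℕ)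
    {φ ψ : Sect2.CPair (F.P (recordK₀ F Mc k + n)) (MatA 2)}
    (h : Sect2.agreeOnSet (Sect2.domSites (F.P (recordK₀ F Mc k + n)) Mc (k + 1) (g3cFull F Mc k (recordK₀ F Mc k + n))) φ ψ) :
    nonB0Block F k (recordK₀ F Mc k + n) (TC n φ) = nonB0Block F k (recordK₀ F Mc k + n) (TC n ψ) := by
  obtain ⟨-, -, -, -, -, -, -, hSum, -, hLoc, -⟩ := hP
  ext i j
  rw [nonB0Block, nonB0Block, Matrix.of_apply, Matrix.of_apply, hSum n φ, hSum n ψ]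
  refine Finset.sum_congr rfl fun Y _ => ?_
  have hY : (Y.1 : Finset _) ⊆ (g3cFull F Mc k (recordK₀ F Mc k + n)).1 := fun c _ => mem_g3cFull F Mc k _ c
  rw [hLoc n Y φ ψ (Sect2.agreeOnSet_mono (domSites_subset_of_subset (F.P (recordK₀ F Mc k + n)) Mc (k + 1) hY) h)]

/-- ★ **ROW (g4) FOR EVERY PAIR**: `EG x n X` reads the pair on `domSites X` only. [cite: Balaban1987RG1, (1.7) p.261] -/
theorem g3cEG_congr (hP : P0CarrierClauses F a₀ δ₀ c₀ γ₀ γ₁ Mc α₀ α₁ ε₂₉ k TC TY TZY AdM AdZ) (n : ℕ) (x : ℝ)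
    (X : (recordDomSys F Mc k (recordK₀ F Mc k + n)).Dom) {φ ψ : Sect2.CPair (F.P (recordK₀ F Mc k + n)) (MatA 2)}
    (h : Sect2.agreeOnSet (Sect2.domSites (F.P (recordK₀ F Mc k + n)) Mc (k + 1) X) φ ψ) :
    g3cEG F Mc k (recordK₀ F Mc k + n) (TC n) (TY n) x X φ = g3cEG F Mc k (recordK₀ F Mc k + n) (TC n) (TY n) x X ψ := by
  rw [g3cEG, g3cEG]
  by_cases hX : X = g3cFull F Mc k (recordK₀ F Mc k + n)
  · subst hX
    have hsum : ∑ Y ∈ Finset.univ.erase (g3cFull F Mc k (recordK₀ F Mc k + n)), g3cW F Mc k (recordK₀ F Mc k + n) (TY n) x φ Y =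
        ∑ Y ∈ Finset.univ.erase (g3cFull F Mc k (recordK₀ F Mc k + n)), g3cW F Mc k (recordK₀ F Mc k + n) (TY n) x ψ Y := by
      refine Finset.sum_congr rfl fun Y _ => ?_
      have hY : (Y.1 : Finset _) ⊆ (g3cFull F Mc k (recordK₀ F Mc k + n)).1 := fun c _ => mem_g3cFull F Mc k _ c
      exact g3cW_congr hP n Y (Sect2.agreeOnSet_mono (domSites_subset_of_subset (F.P (recordK₀ F Mc k + n)) Mc (k + 1) hY) h) x
    rw [G3CInv.collect_self, G3CInv.collect_self, nonB0Block_TC_congr hP n h, hsum]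
  · rw [G3CInv.collect_of_ne hX, G3CInv.collect_of_ne hX]
    exact g3cW_congr hP n X h x

/-! ## §2  (g6) invariance under the (1.10) action, termwise -/

/-- A diagonal matrix whose entries depend only on the BOND commutes with the non-`b₀` block of the bond-block-diagonal `AdM(u)`. [cite: Balaban1987RG1, (1.10) p.262 (bookkeeping)] -/
theorem diagonal_comm_adM (hP : P0CarrierClauses F a₀ δ₀ c₀ γ₀ γ₁ Mc α₀ α₁ ε₂₉ k TC TY TZY AdM AdZ) (n : ℕ)
    (u : Site (F.P (recordK₀ F Mc k + n)) 0 → (MatA 2)ˣ) (d : NonB0Idx F k (recordK₀ F Mc k + n) → ℂ)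
    (hd : ∀ i j : NonB0Idx F k (recordK₀ F Mc k + n), i.1.1 = j.1.1 → d i = d j) :
    (AdM n u).submatrix (Subtype.val : NonB0Idx F k (recordK₀ F Mc k + n) → _) Subtype.val * Matrix.diagonal d =
      Matrix.diagonal d * (AdM n u).submatrix (Subtype.val : NonB0Idx F k (recordK₀ F Mc k + n) → _) Subtype.val := by
  obtain ⟨-, -, -, -, -, -, hP3, -⟩ := hP
  obtain ⟨-, hBlk, -⟩ := hP3 n u
  ext i j
  rw [Matrix.mul_diagonal, Matrix.diagonal_mul, Matrix.submatrix_apply]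
  by_cases hij : i.1.1 = j.1.1
  · rw [hd i j hij, mul_comm]
  · rw [hBlk i.1 j.1 hij, mul_zero, zero_mul]

/-- `P_Z` commutes with `A = AdM(u)|_{nonB₀}`. [folklore] -/
theorem g3cProj_comm_adM (hP : P0CarrierClauses F a₀ δ₀ c₀ γ₀ γ₁ Mc α₀ α₁ ε₂₉ k TC TY TZY AdM AdZ) (n : ℕ)
    (u : Site (F.P (recordK₀ F Mc k + n)) 0 → (MatA 2)ˣ) (Z : (recordDomSys F Mc k (recordK₀ F Mc k + n)).Dom) :
    (AdM n u).submatrix (Subtype.val : NonB0Idx F k (recordK₀ F Mc k + n) → _) Subtype.val * g3cProj F Mc k (recordK₀ F Mc k + n) Z =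
      g3cProj F Mc k (recordK₀ F Mc k + n) Z * (AdM n u).submatrix (Subtype.val : NonB0Idx F k (recordK₀ F Mc k + n) → _) Subtype.val := by
  rw [g3cProj]
  refine diagonal_comm_adM hP n u _ fun i j hij => ?_
  have : g3cInDom F Mc k (recordK₀ F Mc k + n) Z i ↔ g3cInDom F Mc k (recordK₀ F Mc k + n) Z j := by unfold g3cInDom; rw [hij]
  by_cases hi : g3cInDom F Mc k (recordK₀ F Mc k + n) Z i
  · rw [if_pos hi, if_pos (this.1 hi)]
  · rw [if_neg hi, if_neg (fun hj => hi (this.2 hj))]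

/-- `𝟙_□` commutes with `A = AdM(u)|_{nonB₀}`. [folklore] -/
theorem g3cInd_comm_adM (hP : P0CarrierClauses F a₀ δ₀ c₀ γ₀ γ₁ Mc α₀ α₁ ε₂₉ k TC TY TZY AdM AdZ) (n : ℕ)
    (u : Site (F.P (recordK₀ F Mc k + n)) 0 → (MatA 2)ˣ) (q : TPt (F.P (recordK₀ F Mc k + n)).d (Sect2.domCount (F.P (recordK₀ F Mc k + n)) Mc (k + 1))) :
    (AdM n u).submatrix (Subtype.val : NonB0Idx F k (recordK₀ F Mc k + n) → _) Subtype.val * g3cInd F Mc k (recordK₀ F Mc k + n) q =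
      g3cInd F Mc k (recordK₀ F Mc k + n) q * (AdM n u).submatrix (Subtype.val : NonB0Idx F k (recordK₀ F Mc k + n) → _) Subtype.val := by
  rw [g3cInd]
  refine diagonal_comm_adM hP n u _ fun i j hij => ?_
  simp only [hij]

/-- From `A·D = D·A` and `A` a unit: `A⁻¹·D = D·A⁻¹`. [folklore] -/
theorem inv_comm_of_comm {ι : Type*} [Fintype ι] [DecidableEq ι] {A D : Matrix ι ι ℂ} (hU : IsUnit A.det) (h : A * D = D * A) : A⁻¹ * D = D * A⁻¹ := by
  calc A⁻¹ * D = A⁻¹ * D * (A * A⁻¹) := by rw [Matrix.mul_nonsing_inv _ hU, Matrix.mul_one]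
    _ = A⁻¹ * (D * A) * A⁻¹ := by simp only [Matrix.mul_assoc]
    _ = A⁻¹ * (A * D) * A⁻¹ := by rw [h]
    _ = D * A⁻¹ := by rw [← Matrix.mul_assoc, Matrix.nonsing_inv_mul _ hU, Matrix.one_mul]

/-- `T_Y` on the non-`b₀` block conjugates: `[T_Y(u·φ)] = A·[T_Y(φ)]·A⁻¹` ((P3)). [cite: Balaban1987RG1, (1.10) p.262, (1.19) p.263] -/
theorem nonB0Block_TY_cAct (hP : P0CarrierClauses F a₀ δ₀ c₀ γ₀ γ₁ Mc α₀ α₁ ε₂₉ k TC TY TZY AdM AdZ) (n : ℕ)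
    (u : Site (F.P (recordK₀ F Mc k + n)) 0 → (MatA 2)ˣ) (Y : (recordDomSys F Mc k (recordK₀ F Mc k + n)).Dom) (φ : Sect2.CPair (F.P (recordK₀ F Mc k + n)) (MatA 2)) :
    nonB0Block F k (recordK₀ F Mc k + n) (TY n Y (Sect2.cAct u φ)) =
      (AdM n u).submatrix (Subtype.val : NonB0Idx F k (recordK₀ F Mc k + n) → _) Subtype.val * nonB0Block F k (recordK₀ F Mc k + n) (TY n Y φ) *
        ((AdM n u).submatrix (Subtype.val : NonB0Idx F k (recordK₀ F Mc k + n) → _) Subtype.val)⁻¹ := by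
  obtain ⟨-, -, -, -, -, -, hP3, -⟩ := hP
  obtain ⟨hU, hBlk, hCov⟩ := hP3 n u
  have hdet : IsUnit (AdM n u).det := (Matrix.isUnit_iff_isUnit_det _).1 hU
  have hoff : ∀ i j : FluctIdx F k (recordK₀ F Mc k + n),
      ¬ ((i.1 ∉ Set.range (recordB0 F k (recordK₀ F Mc k + n))) ↔ (j.1 ∉ Set.range (recordB0 F k (recordK₀ F Mc k + n)))) → AdM n u i j = 0 := by
    intro i j hij; apply hBlk i j; intro hb; apply hij; rw [hb]
  have e1 : ∀ ψ : Sect2.CPair (F.P (recordK₀ F Mc k + n)) (MatA 2), nonB0Block F k (recordK₀ F Mc k + n) (TY n Y ψ) =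
      (Matrix.of (TY n Y ψ)).submatrix (Subtype.val : NonB0Idx F k (recordK₀ F Mc k + n) → _) (Subtype.val : NonB0Idx F k (recordK₀ F Mc k + n) → _) := fun ψ => rfl
  rw [e1, e1, hCov Y φ, G3CInv.submatrix_conj_of_offblock hoff hdet]

/-- **The admissible step matrices conjugate**: `S^M_{□,Y}(x, u·φ) = A·S^M_{□,Y}(x, φ)·A⁻¹`. [cite: Balaban1987RG1, (1.19) p.263; Balaban1985BackgroundPropagators, (3.88) p.409] -/
theorem g3cStepM_cAct (hP : P0CarrierClauses F a₀ δ₀ c₀ γ₀ γ₁ Mc α₀ α₁ ε₂₉ k TC TY TZY AdM AdZ) (n : ℕ)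
    (u : Site (F.P (recordK₀ F Mc k + n)) 0 → (MatA 2)ˣ) (x : ℝ) (φ : Sect2.CPair (F.P (recordK₀ F Mc k + n)) (MatA 2))
    (s : TPt (F.P (recordK₀ F Mc k + n)).d (Sect2.domCount (F.P (recordK₀ F Mc k + n)) Mc (k + 1)) × (recordDomSys F Mc k (recordK₀ F Mc k + n)).Dom) :
    g3cStepM F Mc k (recordK₀ F Mc k + n) (TY n) x (Sect2.cAct u φ) s =
      (AdM n u).submatrix (Subtype.val : NonB0Idx F k (recordK₀ F Mc k + n) → _) Subtype.val * g3cStepM F Mc k (recordK₀ F Mc k + n) (TY n) x φ s *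
        ((AdM n u).submatrix (Subtype.val : NonB0Idx F k (recordK₀ F Mc k + n) → _) Subtype.val)⁻¹ := by
  set A := (AdM n u).submatrix (Subtype.val : NonB0Idx F k (recordK₀ F Mc k + n) → _) Subtype.val with hA
  have hU : IsUnit A.det := (g3cLocOp_cAct hP n s.2 u φ).1
  unfold g3cStepM
  split_ifs
  · rw [Matrix.mul_zero, Matrix.zero_mul]
  rw [g3cStep, g3cStep, nonB0Block_TY_cAct hP n u s.2 φ, g3cLocInv_cAct hP n _ u x φ]
  have hP' : A⁻¹ * g3cProj F Mc k (recordK₀ F Mc k + n) (g3cBlk F Mc k (recordK₀ F Mc k + n) s.1) = g3cProj F Mc k (recordK₀ F Mc k + n) (g3cBlk F Mc k (recordK₀ F Mc k + n) s.1) * A⁻¹ :=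
    inv_comm_of_comm hU (g3cProj_comm_adM hP n u _)
  have hI' : A⁻¹ * g3cInd F Mc k (recordK₀ F Mc k + n) s.1 = g3cInd F Mc k (recordK₀ F Mc k + n) s.1 * A⁻¹ := inv_comm_of_comm hU (g3cInd_comm_adM hP n u _)
  rw [← hA]
  -- A T A⁻¹ P (A G A⁻¹) 𝟙 = A T (A⁻¹ P A) G A⁻¹ 𝟙 = A T P G (A⁻¹ 𝟙) = A (T P G 𝟙) A⁻¹
  calc A * nonB0Block F k (recordK₀ F Mc k + n) (TY n s.2 φ) * A⁻¹ * g3cProj F Mc k (recordK₀ F Mc k + n) (g3cBlk F Mc k (recordK₀ F Mc k + n) s.1) *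
        (A * g3cLocInv F Mc k (recordK₀ F Mc k + n) (TY n) (g3cBlk F Mc k (recordK₀ F Mc k + n) s.1) x φ * A⁻¹) * g3cInd F Mc k (recordK₀ F Mc k + n) s.1
      = A * nonB0Block F k (recordK₀ F Mc k + n) (TY n s.2 φ) * (A⁻¹ * g3cProj F Mc k (recordK₀ F Mc k + n) (g3cBlk F Mc k (recordK₀ F Mc k + n) s.1)) *
        A * g3cLocInv F Mc k (recordK₀ F Mc k + n) (TY n) (g3cBlk F Mc k (recordK₀ F Mc k + n) s.1) x φ * (A⁻¹ * g3cInd F Mc k (recordK₀ F Mc k + n) s.1) := by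
          simp only [Matrix.mul_assoc]
    _ = A * nonB0Block F k (recordK₀ F Mc k + n) (TY n s.2 φ) * (g3cProj F Mc k (recordK₀ F Mc k + n) (g3cBlk F Mc k (recordK₀ F Mc k + n) s.1) * A⁻¹) *
        A * g3cLocInv F Mc k (recordK₀ F Mc k + n) (TY n) (g3cBlk F Mc k (recordK₀ F Mc k + n) s.1) x φ * (g3cInd F Mc k (recordK₀ F Mc k + n) s.1 * A⁻¹) := by rw [hP', hI']
    _ = A * nonB0Block F k (recordK₀ F Mc k + n) (TY n s.2 φ) * g3cProj F Mc k (recordK₀ F Mc k + n) (g3cBlk F Mc k (recordK₀ F Mc k + n) s.1) * (A⁻¹ * A) *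
        g3cLocInv F Mc k (recordK₀ F Mc k + n) (TY n) (g3cBlk F Mc k (recordK₀ F Mc k + n) s.1) x φ * g3cInd F Mc k (recordK₀ F Mc k + n) s.1 * A⁻¹ := by
          simp only [Matrix.mul_assoc]
    _ = _ := by rw [Matrix.nonsing_inv_mul _ hU, Matrix.mul_one]; simp only [Matrix.mul_assoc]

/-- **The walk terms are invariant under the (1.10) action** (conjugation telescopes inside the trace). [cite: Balaban1987RG1, (1.19) p.263; Balaban1985UV3, (63) p.272] -/
theorem g3cWalkTerm_cAct (hP : P0CarrierClauses F a₀ δ₀ c₀ γ₀ γ₁ Mc α₀ α₁ ε₂₉ k TC TY TZY AdM AdZ) (n : ℕ)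
    (u : Site (F.P (recordK₀ F Mc k + n)) 0 → (MatA 2)ˣ) (x : ℝ) (φ : Sect2.CPair (F.P (recordK₀ F Mc k + n)) (MatA 2))
    (q₀ : TPt (F.P (recordK₀ F Mc k + n)).d (Sect2.domCount (F.P (recordK₀ F Mc k + n)) Mc (k + 1))) {m : ℕ}
    (w : Fin m → TPt (F.P (recordK₀ F Mc k + n)).d (Sect2.domCount (F.P (recordK₀ F Mc k + n)) Mc (k + 1)) × (recordDomSys F Mc k (recordK₀ F Mc k + n)).Dom) :
    g3cWalkTerm F Mc k (recordK₀ F Mc k + n) (TY n) x (Sect2.cAct u φ) q₀ w = g3cWalkTerm F Mc k (recordK₀ F Mc k + n) (TY n) x φ q₀ w := by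
  set A := (AdM n u).submatrix (Subtype.val : NonB0Idx F k (recordK₀ F Mc k + n) → _) Subtype.val with hA
  have hU : IsUnit A.det := (g3cLocOp_cAct hP n (g3cBlk F Mc k (recordK₀ F Mc k + n) q₀) u φ).1
  have hAA : A * A⁻¹ = 1 := Matrix.mul_nonsing_inv _ hU
  have hAA' : A⁻¹ * A = 1 := Matrix.nonsing_inv_mul _ hU
  have hI' : A⁻¹ * g3cInd F Mc k (recordK₀ F Mc k + n) q₀ = g3cInd F Mc k (recordK₀ F Mc k + n) q₀ * A⁻¹ := inv_comm_of_comm hU (g3cInd_comm_adM hP n u _)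
  unfold g3cWalkTerm
  have hlist : (List.ofFn fun i => g3cStepM F Mc k (recordK₀ F Mc k + n) (TY n) x (Sect2.cAct u φ) (w i)) =
      (List.ofFn fun i => g3cStepM F Mc k (recordK₀ F Mc k + n) (TY n) x φ (w i)).map fun S => A * S * A⁻¹ := by
    rw [List.map_ofFn]
    congr 1
    funext i
    simp only [Function.comp, g3cStepM_cAct hP n u x φ (w i), hA]
  rw [hlist, listProd_conj hAA hAA', g3cLocInv_cAct hP n _ u x φ, ← hA]
  calc (A * g3cLocInv F Mc k (recordK₀ F Mc k + n) (TY n) (g3cBlk F Mc k (recordK₀ F Mc k + n) q₀) x φ * A⁻¹ * g3cInd F Mc k (recordK₀ F Mc k + n) q₀ *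
        (A * (List.ofFn fun i => g3cStepM F Mc k (recordK₀ F Mc k + n) (TY n) x φ (w i)).prod * A⁻¹)).trace
      = (A * (g3cLocInv F Mc k (recordK₀ F Mc k + n) (TY n) (g3cBlk F Mc k (recordK₀ F Mc k + n) q₀) x φ * (A⁻¹ * g3cInd F Mc k (recordK₀ F Mc k + n) q₀) *
          A * (List.ofFn fun i => g3cStepM F Mc k (recordK₀ F Mc k + n) (TY n) x φ (w i)).prod) * A⁻¹).trace := by simp only [Matrix.mul_assoc]
    _ = (A * (g3cLocInv F Mc k (recordK₀ F Mc k + n) (TY n) (g3cBlk F Mc k (recordK₀ F Mc k + n) q₀) x φ * g3cInd F Mc k (recordK₀ F Mc k + n) q₀ * (A⁻¹ * A) *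
          (List.ofFn fun i => g3cStepM F Mc k (recordK₀ F Mc k + n) (TY n) x φ (w i)).prod) * A⁻¹).trace := by rw [hI']; simp only [Matrix.mul_assoc]
    _ = (A * (g3cLocInv F Mc k (recordK₀ F Mc k + n) (TY n) (g3cBlk F Mc k (recordK₀ F Mc k + n) q₀) x φ * g3cInd F Mc k (recordK₀ F Mc k + n) q₀ *
          (List.ofFn fun i => g3cStepM F Mc k (recordK₀ F Mc k + n) (TY n) x φ (w i)).prod) * A⁻¹).trace := by rw [hAA', Matrix.mul_one]
    _ = _ := by rw [Matrix.trace_mul_cycle, hAA', Matrix.one_mul]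

/-- **The walk piece `W(X)` is invariant under the (1.10) action.** [cite: Balaban1987RG1, (1.19) p.263] -/
theorem g3cW_cAct (hP : P0CarrierClauses F a₀ δ₀ c₀ γ₀ γ₁ Mc α₀ α₁ ε₂₉ k TC TY TZY AdM AdZ) (n : ℕ)
    (u : Site (F.P (recordK₀ F Mc k + n)) 0 → (MatA 2)ˣ) (x : ℝ) (φ : Sect2.CPair (F.P (recordK₀ F Mc k + n)) (MatA 2)) (X : (recordDomSys F Mc k (recordK₀ F Mc k + n)).Dom) :
    g3cW F Mc k (recordK₀ F Mc k + n) (TY n) x (Sect2.cAct u φ) X = g3cW F Mc k (recordK₀ F Mc k + n) (TY n) x φ X := by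
  have hm : ∀ m : ℕ, g3cWm F Mc k (recordK₀ F Mc k + n) (TY n) x (Sect2.cAct u φ) m X = g3cWm F Mc k (recordK₀ F Mc k + n) (TY n) x φ m X := by
    intro m
    rw [g3cWm, g3cWm]
    refine Finset.sum_congr rfl fun q₀ _ => Finset.sum_congr rfl fun w _ => ?_
    by_cases hloc : g3cWalkLoc F Mc k (recordK₀ F Mc k + n) q₀ w = X.1
    · rw [if_pos hloc, if_pos hloc, g3cWalkTerm_cAct hP n u x φ q₀ w]
    · rw [if_neg hloc, if_neg hloc]
  rw [g3cW, g3cW]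
  exact tsum_congr fun m => by rw [hm m]

/-- ★ **ROW (g6) FOR EVERY PAIR**: `EG x n X (u·φ) = EG x n X φ`. [cite: Balaban1987RG1, (1.19) p.263; Balaban1985UV3, (63) p.272] -/
theorem g3cEG_cAct (hP : P0CarrierClauses F a₀ δ₀ c₀ γ₀ γ₁ Mc α₀ α₁ ε₂₉ k TC TY TZY AdM AdZ) (n : ℕ) (x : ℝ)
    (X : (recordDomSys F Mc k (recordK₀ F Mc k + n)).Dom) (u : Site (F.P (recordK₀ F Mc k + n)) 0 → (MatA 2)ˣ) (φ : Sect2.CPair (F.P (recordK₀ F Mc k + n)) (MatA 2)) :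
    g3cEG F Mc k (recordK₀ F Mc k + n) (TC n) (TY n) x X (Sect2.cAct u φ) = g3cEG F Mc k (recordK₀ F Mc k + n) (TC n) (TY n) x X φ := by
  rw [g3cEG, g3cEG]
  have htot : (((x : ℂ) • (1 : Matrix (NonB0Idx F k (recordK₀ F Mc k + n)) (NonB0Idx F k (recordK₀ F Mc k + n)) ℂ) +
      nonB0Block F k (recordK₀ F Mc k + n) (TC n (Sect2.cAct u φ)))⁻¹).trace =
      (((x : ℂ) • (1 : Matrix (NonB0Idx F k (recordK₀ F Mc k + n)) (NonB0Idx F k (recordK₀ F Mc k + n)) ℂ) +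
        nonB0Block F k (recordK₀ F Mc k + n) (TC n φ))⁻¹).trace :=
    trace_resolvent_nonB0_cAct F hP n u φ (x : ℂ)
  by_cases hX : X = g3cFull F Mc k (recordK₀ F Mc k + n)
  · subst hX
    have hsum : ∑ Y ∈ Finset.univ.erase (g3cFull F Mc k (recordK₀ F Mc k + n)), g3cW F Mc k (recordK₀ F Mc k + n) (TY n) x (Sect2.cAct u φ) Y =
        ∑ Y ∈ Finset.univ.erase (g3cFull F Mc k (recordK₀ F Mc k + n)), g3cW F Mc k (recordK₀ F Mc k + n) (TY n) x φ Y :=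
      Finset.sum_congr rfl fun Y _ => g3cW_cAct hP n u x φ Y
    rw [G3CInv.collect_self, G3CInv.collect_self, htot, hsum]
  · rw [G3CInv.collect_of_ne hX, G3CInv.collect_of_ne hX]
    exact g3cW_cAct hP n u x φ X

end LocalGauge

end Summit.QuantumFields.YangMills.Theorems.BalabanUVNodesPortS1

end
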